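import Literature.Computability.QuantumComplexity.OneCleanQubitAmplifier
import Literature.Computability.QuantumComplexity.Lemma24SignHard
import Literature.Computability.QuantumComplexity.QSimSignProofs
import HarnessLib

/-!
# `DQC1 ⊆ BQP` (Knill–Laflamme 1998): discharge of `knillLaflamme1998_DQC1_subset_BQP`

Topic `Literature/Computability/QuantumComplexity`; sibling proof file (theorems only) of
`OneCleanQubit.lean`, whose named fact `knillLaflamme1998_DQC1_subset_BQP`
(`∀ L, IsDQC1Decidable L → L ∈ BQP`: every language decided in the one-clean-qubit model — per-input
polynomial-time generated oracle-free Clifford+`T` circuits, clean wire `0`, maximally mixed register,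
two-sided bias `1/(q(|x|)+1)` — is in the tree's `TM2`-uniform `BQP`) it discharges. Sources:
E. Knill, R. Laflamme, *Power of one bit of quantum information*, Phys. Rev. Lett. 81 (1998), p. 5673
(DQC1: "one bit in a pure state and the rest completely random") and p. 5675 ("a new model of
computation (DQC1) with power between classical computation and deterministic quantum computation
with pure states"); P. W. Shor, S. P. Jordan, Quantum Inf. Comput. 8 (2008), §1 (the decision class,
"strictly weaker than standard quantum computers"). No proof of the containment is printed (it is the
folklore remark that random bits can be made from pure ones); the tree's proof:

1. `OneCleanQubitPurification.lean` — the maximally mixed register as halves of Bell pairs: the purified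
   block accepts with exactly the one-clean-qubit acceptance probability (Shor–Jordan §1, p. 3;
   Nielsen–Chuang §2.5);
2. `OneCleanQubitAmplifier.lean` — `K = 2(q+1)²+1` purified copies side by side and a reversible
   majority onto wire `0`: error `≤ 1/(4Kη²) ≤ 1/8` at advantage `η = 1/(q+1)`
   (Bennett–Bernstein–Brassard–Vazirani 1997, Thm. 4.13), and the amplified circuits are printed in
   polynomial time from the given `FP` descriptions;
3. here — **`mem_BQP_of_generated_circuits`**: languages decided with error `1/3` by polynomial-time
   generated Clifford+`T` circuits are in `BQP`, by the Karp reduction `Lemma24.outF` to QSIM over the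
   sign basis (`isYes_lemma24Instance`, `isNo_lemma24Instance`; Aaronson–Ambainis 2018, §6 Lemma 24),
   its membership `AaronsonAmbainis2018_lemma24_sign_mem_holds` and the closure of `PromiseBQP` under
   Karp reductions (`mem_PromiseBQP_of_polyTimeReducible`; Watrous 2009, §IV.3) — and the assembly
   **`knillLaflamme1998_DQC1_subset_BQP_holds`**, `DQC1_subset_BQP`.

## References

* E. Knill, R. Laflamme, Phys. Rev. Lett. 81 (1998) 5672–5675 (arXiv:quant-ph/9802037, pp. 4, 6) [KnillLaflamme1998].
* P. W. Shor, S. P. Jordan, Quantum Inf. Comput. 8 (2008) 681–714, §1 [ShorJordan2008].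
* C. H. Bennett, E. Bernstein, G. Brassard, U. Vazirani, SIAM J. Comput. 26 (1997), Thm. 4.13 [BennettBernsteinBrassardVazirani1997].
* S. Aaronson, A. Ambainis, *Forrelation*, SIAM J. Comput. 47 (2018), §6 Lemma 24 [AaronsonAmbainis2018].
* J. Watrous, *Quantum computational complexity* (2009), §IV.3 [Watrous2009].
-/

noncomputable section

namespace Literature.Computability.QuantumComplexity


/-! ## Part VI. Assembly: `DQC1 ⊆ BQP` -/

section Assembly

open _root_.Computability Complexity Cryptography Lemma24 RevDesc

/-- **Languages decided by polynomial-time generated Clifford+`T` circuits with two-sided error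
`1/3` are in `BQP`.** If `x ↦ D x` (an oracle-free circuit on `1 + anc x` wires, run on `|0…0⟩`,
wire `0` measured) accepts with probability `≥ 2/3` on `L` and `≤ 1/3` off `L`, and the record
`⟨[0], ⟨bin 1, ⟨1^{anc x}, code of D x⟩⟩⟩` is an `FP` function of `x`, then `L ∈ BQP`: composing with
`Lemma24.outF` Karp-reduces `L` to QSIM over the sign basis (`isYes_lemma24Instance`,
`isNo_lemma24Instance`: AA Lemma 24, hardness construction), which is in `PromiseBQP`
(`AaronsonAmbainis2018_lemma24_sign_mem_holds`), and `PromiseBQP` is closed downwards under Karp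
reductions (`mem_PromiseBQP_of_polyTimeReducible`; Watrous 2009, §IV.3: polynomial-time generated
families). [cite: AaronsonAmbainis2018, §6 Lemma 24 (p. 26)] [cite: Watrous2009, §IV.3] -/
theorem mem_BQP_of_generated_circuits {L : Language Bool} (anc : List Bool → ℕ)
    (D : (x : List Bool) → QCircuit cliffordT (1 + anc x)) (hD : ∀ x, (D x).IsOracleFree)
    (hFP : (fun x => inRec [false] (anc x) ((D x).gates.map shadow)) ∈ FP)
    (hyes : ∀ x ∈ L, 2 / 3 ≤ (D x).acceptProb 0 (fun _ : Fin 1 => false))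
    (hno : ∀ x ∉ L, (D x).acceptProb 0 (fun _ : Fin 1 => false) ≤ 1 / 3) : L ∈ BQP := by
  rw [← ofLanguage_mem_PromiseBQP_iff]
  refine mem_PromiseBQP_of_polyTimeReducible ?_ AaronsonAmbainis2018_lemma24_sign_mem_holds
  refine ⟨outF ∘ fun x => inRec [false] (anc x) ((D x).gates.map shadow), comp_mem_FP outF_mem_FP hFP, ?_, ?_⟩
  · intro x hx
    have happ : (outF ∘ fun x => inRec [false] (anc x) ((D x).gates.map shadow)) x =
        (lemma24Instance (D x) (fun _ : Fin 1 => false)).encode := by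
      rw [Function.comp_apply, outF_inRec [false] _ (wfC_of_mem_map_shadow (hD x)), encode_lemma24Instance (hD x)]
      rfl
    rw [happ]
    exact (encode_mem_qSimSignProblem_yes_iff _).2
      (isYes_lemma24Instance (hD x) (hyes x hx) (QCircuit.acceptProb_le_one_holds cliffordT_isUnitary_holds 0 _ _))
  · intro x hx
    have happ : (outF ∘ fun x => inRec [false] (anc x) ((D x).gates.map shadow)) x =
        (lemma24Instance (D x) (fun _ : Fin 1 => false)).encode := by
      rw [Function.comp_apply, outF_inRec [false] _ (wfC_of_mem_map_shadow (hD x)), encode_lemma24Instance (hD x)]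
      rfl
    rw [happ]
    exact (encode_mem_qSimSignProblem_no_iff _).2
      (isNo_lemma24Instance (hD x) (hno x hx) (QCircuit.acceptProb_nonneg 0 _ _)
        (QCircuit.acceptProb_le_one_holds cliffordT_isUnitary_holds 0 _ _))

/-- The error of the amplifier with `K = 2 (q+1)² + 1` copies at advantage `1/(q+1)` is at most `1/3`
(in fact `≤ 1/8`). [cite: BennettBernsteinBrassardVazirani1997, Thm. 4.13 (proof)] -/
theorem amp_error_le (qn : ℕ) :
    1 / (4 * ((2 * (qn + 1) ^ 2 + 1 : ℕ) : ℝ) * (1 / ((qn : ℝ) + 1)) ^ 2) ≤ 1 / 3 := by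
  have hm : (0 : ℝ) < (qn : ℝ) + 1 := by positivity
  refine one_div_le_one_div_of_le (by norm_num) ?_
  have e : 4 * ((2 * (qn + 1) ^ 2 + 1 : ℕ) : ℝ) * (1 / ((qn : ℝ) + 1)) ^ 2 = 8 + 4 / ((qn : ℝ) + 1) ^ 2 := by
    push_cast
    field_simp
    ring
  rw [e]
  have : (0 : ℝ) ≤ 4 / ((qn : ℝ) + 1) ^ 2 := by positivity
  linarith

/-- **`DQC1 ⊆ BQP`** (Knill–Laflamme 1998, p. 5675: the one-clean-qubit model has "power between
classical computation and deterministic quantum computation with pure states"; Shor–Jordan 2008, §1: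
one clean qubit computers are "strictly weaker than standard quantum computers"). Discharge of the
named fact `knillLaflamme1998_DQC1_subset_BQP` in the tree's `TM2`-uniform Clifford+`T` model, by the
folklore argument: (i) the maximally mixed register is one half of `k` Bell pairs, so running the given
circuit on the purified state reproduces the uniform average over basis inputs (`DQC1Amp.sum_accept_purify`;
Shor–Jordan §1 p. 3; Nielsen–Chuang §2.5); (ii) `K = 2(q+1)² + 1` independent purified runs side by side
and a reversible threshold network computing the majority onto wire `0` turn the two-sided bias
`1/(q+1)` into error `≤ 1/8` (`DQC1Amp.acceptProb_circ_ge/le`, Bennett–Bernstein–Brassard–Vazirani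
1997, Thm. 4.13: weighted Chebyshev bound); (iii) the amplified circuits are printed in polynomial time
from the `FP` descriptions of the given circuits (`DQC1Amp.desc_mem_FP`), so the language Karp-reduces
to the tree's `PromiseBQP`-complete circuit problem (`mem_BQP_of_generated_circuits`, via AA Lemma 24
and QSIM `∈ PromiseBQP`). [cite: KnillLaflamme1998, p. 5673 (DQC1) and p. 5675 (DQC1 between classical and DQCp)]
[cite: ShorJordan2008, §1 pp. 2–3] [cite: BennettBernsteinBrassardVazirani1997, Thm. 4.13] -/
theorem knillLaflamme1998_DQC1_subset_BQP_holds : knillLaflamme1998_DQC1_subset_BQP := by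
  intro L hL
  obtain ⟨k, C, hC, hdesc, q, hq⟩ := hL
  -- the register size is bounded by the (polynomial) description length
  obtain ⟨pc, hpc⟩ := exists_poly_length_le_of_mem_FP hdesc
  have hk : ∀ x, k x ≤ pc.eval x.length := fun x => by
    have h := hpc x
    simp only [QCircuit.sigmaEncode, length_boolPair, DQC1Amp.length_unaryEncodeNat'] at h
    omega
  let P : DQC1Amp.Params := ⟨k, C, hC, pc, hk, (q + 1) ^ 2⟩
  have hK : ∀ n, DQC1Amp.K P n = 2 * (q.eval n + 1) ^ 2 + 1 := fun n => by
    simp [DQC1Amp.K, DQC1Amp.K', P]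
  refine mem_BQP_of_generated_circuits (fun x => DQC1Amp.anc P x.length) (fun x => DQC1Amp.circ P x)
    DQC1Amp.circ_isOracleFree ?_ (fun x hx => ?_) (fun x hx => ?_)
  · -- the record of the amplified circuit is in `FP`
    have h := DQC1Amp.desc_mem_FP (P := P) hdesc
    refine (congrArg (· ∈ FP) (funext fun x => ?_)).mpr h
    rw [inRec, ← encode_eq_encList_shadow (DQC1Amp.circ_isOracleFree (P := P) x)]
    rfl
  · -- yes-instances
    have hη : (0 : ℝ) < 1 / (((q.eval x.length : ℕ) : ℝ) + 1) := by positivity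
    have h := DQC1Amp.acceptProb_circ_ge (P := P) x hη ((hq x).1 hx)
    have he := amp_error_le (q.eval x.length)
    rw [← hK] at he
    change 1 - 1 / (4 * (DQC1Amp.K P x.length : ℝ) * (1 / (((q.eval x.length : ℕ) : ℝ) + 1)) ^ 2) ≤ _ at h
    linarith
  · -- no-instances
    have hη : (0 : ℝ) < 1 / (((q.eval x.length : ℕ) : ℝ) + 1) := by positivity
    have h := DQC1Amp.acceptProb_circ_le (P := P) x hη ((hq x).2 hx)
    have he := amp_error_le (q.eval x.length)
    rw [← hK] at he
    change _ ≤ 1 / (4 * (DQC1Amp.K P x.length : ℝ) * (1 / (((q.eval x.length : ℕ) : ℝ) + 1)) ^ 2) at h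
    linarith

/-- Set form: `DQC1 ⊆ BQP`. [cite: KnillLaflamme1998, p. 5675] -/
theorem DQC1_subset_BQP : DQC1 ⊆ BQP :=
  DQC1_subset_BQP_of knillLaflamme1998_DQC1_subset_BQP_holds

end Assembly

end Literature.Computability.QuantumComplexity

end
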